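import Literature.Computability.AlgebraicComplexity.FlipGraphCyclicSymmetry
import HarnessLib

/-!
# The cyclic group generated by a symmetry of finite order (Moosbauer–Poole 2025, §2)

Topic `Literature/Computability/AlgebraicComplexity`; companion of `FlipGraphCyclicSymmetry.lean`
(the instance `C₃ = ⟨ρ⟩`, `cycRep`/`cycAction`) and `FlipGraphOrbitFlips.lean` (orbits, MP Thm. 4 for a
finite group `G` acting by symmetries). Source: J. Moosbauer, M. Poole, *Flip Graphs with Symmetry and
New Matrix Multiplication Schemes*, ISSAC 2025 = arXiv:2502.04514 (MP), §2: "let `G` be a finite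
subgroup of the symmetry group of matrix multiplication … In the present paper we consider two
subgroups … `C₃` … and `C₃ × ℤ₂`", both cyclic (of order `3` and `6`), each generated by one
symmetry `g` (Lemma 7: "It is sufficient to show the claim for a generator `g` of `G`").

Here, for ANY symmetry `φ` of a tensor `t` with `φ^m = id`: the representation
`ℤ/m → Symmetry t`, `k ↦ φ^k` (`Symmetry.cyclicRep`), the induced action of the cyclic group
`C_m = Multiplicative (ZMod m)` on the tensor space BY these symmetries (`Symmetry.cyclicAction`, via
`DistribMulAction.ofSymmetries`, so that `FlipGraphOrbitFlips.lean` applies with `hρ = rfl`), its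
membership in KM's group `G` when `φ ∈ G`, and the orbit count: **the orbit of `X` under `C_m` has
`m` elements iff no `φ^k`, `0 < k < m`, fixes `X`** (`Symmetry.card_orbitFinset_cyclic_eq_iff`).
Everything is PROVED; no named facts.

## References

* J. Moosbauer, M. Poole, *Flip Graphs with Symmetry and New Matrix Multiplication Schemes*,
  ISSAC 2025, doi:10.1145/3747199.3747566, arXiv:2502.04514, §2 (finite subgroups of the symmetry
  group; `C₃`, `C₃ × ℤ₂`), Def. 2, Thm. 4, Lemma 7. [MoosbauerPoole2025]
* M. Kauers, J. Moosbauer, *Flip Graphs for Matrix Multiplication*, ISSAC 2023, arXiv:2212.01175, §2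
  (the symmetry group). [KauersMoosbauer2022FlipGraphs]
-/

namespace Literature.Computability.AlgebraicComplexity

open scoped BigOperators

namespace FlipGraph

section CyclicRep

variable {K : Type*} [Field K] {ι κ μ : Type*} {t : ι → κ → μ → K}

/-- Iterates of a symmetry with `φ^m = id` only depend on the exponent mod `m`.
[cite: MoosbauerPoole2025, §2 (finite cyclic subgroups `C₃`, `C₃ × ℤ₂`)] -/
theorem Symmetry.iterate_eq_iterate_mod (φ : Symmetry t) {m : ℕ}
    (h : ∀ T, (φ.toLinearEquiv)^[m] T = T) (k : ℕ) (T : ι → κ → μ → K) :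
    (φ.toLinearEquiv)^[k] T = (φ.toLinearEquiv)^[k % m] T := by
  conv_lhs => rw [← Nat.mod_add_div k m, Function.iterate_add_apply, Function.iterate_mul]
  rw [Function.iterate_fixed (h T)]

/-- **The cyclic group `C_m = ⟨φ⟩` as a family of symmetries:** `k ↦ φ^k`, `k ∈ ℤ/m`.
[cite: MoosbauerPoole2025, §2 (finite subgroups of the symmetry group)] -/
def Symmetry.cyclicRep (φ : Symmetry t) (m : ℕ) (g : Multiplicative (ZMod m)) : Symmetry t :=
  φ.pow (Multiplicative.toAdd g).val

/-- `φ^k` acts as the `k`-fold iterate. [cite: MoosbauerPoole2025, §2] -/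
theorem Symmetry.cyclicRep_apply (φ : Symmetry t) (m : ℕ) (g : Multiplicative (ZMod m))
    (T : ι → κ → μ → K) :
    (φ.cyclicRep m g).toLinearEquiv T = (φ.toLinearEquiv)^[(Multiplicative.toAdd g).val] T :=
  φ.pow_apply _ T

/-- **The action of `C_m` on the tensor space by the symmetries `φ^k`** (`g • T = (φ.cyclicRep m g) T`;
a `def` — enable with `letI`/`attribute [local instance]`), for `φ^m = id`.
[cite: MoosbauerPoole2025, §2 ("the symmetry transformations act linearly")] -/
@[reducible] def Symmetry.cyclicAction (φ : Symmetry t) (m : ℕ) [NeZero m]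
    (h : ∀ T, (φ.toLinearEquiv)^[m] T = T) :
    DistribMulAction (Multiplicative (ZMod m)) (ι → κ → μ → K) :=
  DistribMulAction.ofSymmetries (φ.cyclicRep m)
    (fun T => by
      rw [Symmetry.cyclicRep_apply, toAdd_one, ZMod.val_zero]
      rfl)
    (fun g g' T => by
      rw [Symmetry.cyclicRep_apply, Symmetry.cyclicRep_apply, Symmetry.cyclicRep_apply,
        ← Function.iterate_add_apply, toAdd_mul, ZMod.val_add, ← φ.iterate_eq_iterate_mod h])

/-- With this action `(φ.cyclicRep m g) T = g • T` by definition: the hypothesis `hρ` of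
`FlipGraphOrbitFlips.lean` (MP Thm. 4). [cite: MoosbauerPoole2025, §2 and Thm. 4] -/
theorem Symmetry.cyclicRep_smul (φ : Symmetry t) (m : ℕ) [NeZero m]
    (h : ∀ T, (φ.toLinearEquiv)^[m] T = T) (g : Multiplicative (ZMod m)) (T : ι → κ → μ → K) :
    letI := φ.cyclicAction m h
    (φ.cyclicRep m g).toLinearEquiv T = g • T :=
  rfl

variable [Fintype ι] [Fintype κ] [Fintype μ]

/-- `|C_m| = m`. [folklore] -/
private theorem card_Cm (m : ℕ) [NeZero m] : Fintype.card (Multiplicative (ZMod m)) = m := by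
  rw [Fintype.card_multiplicative, ZMod.card]

/-- **Orbits of size `|G|` for a cyclic `G = ⟨φ⟩` of order `m`:** the orbit of `X` has `m` elements
iff none of `φ, φ², …, φ^{m−1}` fixes `X` (MP Lemma 7: "we have to show that for any `s ∈ S`,
`g ∈ G ∖ {e}` we have `g·s ≠ s`"). [cite: MoosbauerPoole2025, Lemma 7 (proof) with Thm. 4] -/
theorem Symmetry.card_orbitFinset_cyclic_eq_iff [DecidableEq K] (φ : Symmetry t) (m : ℕ) [NeZero m]
    (h : ∀ T, (φ.toLinearEquiv)^[m] T = T) (X : ι → κ → μ → K) :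
    letI := φ.cyclicAction m h
    (orbitFinset (Multiplicative (ZMod m)) X).card = m ↔
      ∀ k, 0 < k → k < m → (φ.toLinearEquiv)^[k] X ≠ X := by
  letI := φ.cyclicAction m h
  have e : (orbitFinset (Multiplicative (ZMod m)) X).card = Fintype.card (Multiplicative (ZMod m)) ↔
      (orbitFinset (Multiplicative (ZMod m)) X).card = m := by rw [card_Cm]
  rw [← e, card_orbitFinset_eq_card_iff, stabCard_eq_one_iff]
  constructor
  · intro hstab k hk hkm hfix
    have hg := hstab (Multiplicative.ofAdd (k : ZMod m)) (by
      rw [← φ.cyclicRep_smul m h, Symmetry.cyclicRep_apply, toAdd_ofAdd, ZMod.val_natCast,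
        Nat.mod_eq_of_lt hkm, hfix])
    have hk0 : ((k : ZMod m)) = 0 := by
      have := congrArg Multiplicative.toAdd hg
      rwa [toAdd_ofAdd, toAdd_one] at this
    exact absurd (Nat.le_of_dvd hk ((ZMod.natCast_eq_zero_iff k m).1 hk0)) (not_le.mpr hkm)
  · intro hne g hg
    have hval : (Multiplicative.toAdd g).val = 0 := by
      by_contra h0
      refine hne _ (Nat.pos_of_ne_zero h0) (ZMod.val_lt _) ?_
      rw [← Symmetry.cyclicRep_apply, φ.cyclicRep_smul m h]
      exact hg
    rw [ZMod.val_eq_zero] at hval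
    exact toAdd_eq_zero.mp hval

/-- The orbit of a fixed point of `φ` is a singleton. [cite: MoosbauerPoole2025, Lemma 7 (proof:
"`T` is `G`-invariant by construction")] -/
theorem Symmetry.card_orbitFinset_cyclic_eq_one [DecidableEq K] (φ : Symmetry t) (m : ℕ)
    [NeZero m] (h : ∀ T, (φ.toLinearEquiv)^[m] T = T) {X : ι → κ → μ → K}
    (hX : φ.toLinearEquiv X = X) :
    letI := φ.cyclicAction m h
    (orbitFinset (Multiplicative (ZMod m)) X).card = 1 := by
  letI := φ.cyclicAction m h
  rw [Finset.card_eq_one]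
  refine ⟨X, Finset.eq_singleton_iff_unique_mem.2 ⟨mem_orbitFinset_self X, fun Y hY => ?_⟩⟩
  obtain ⟨g, rfl⟩ := mem_orbitFinset.1 hY
  rw [← φ.cyclicRep_smul m h, Symmetry.cyclicRep_apply]
  exact Function.iterate_fixed hX _

omit [Fintype ι] [Fintype κ] [Fintype μ] in
/-- A scheme mapped to itself by `φ` is invariant under the whole cyclic group `⟨φ⟩`
(MP Def. 2 for `G = C_m`). [cite: MoosbauerPoole2025, Def. 2] -/
theorem Symmetry.isInvariantUnder_cyclicRep (φ : Symmetry t) (m : ℕ) (S : Scheme t)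
    (hS : S.map φ = S) : IsInvariantUnder (Set.range (φ.cyclicRep m)) S := by
  rintro ψ ⟨g, rfl⟩
  unfold Symmetry.cyclicRep
  induction (Multiplicative.toAdd g).val with
  | zero => exact Scheme.map_refl S
  | succ k ih =>
    show S.map ((φ.pow k).trans φ) = S
    rw [Scheme.map_trans, ih, hS]

end CyclicRep

section MatMul

variable {K : Type*} [Field K] {n : ℕ}

/-- Powers of an element of KM's group `G` lie in `G`. [cite: KauersMoosbauer2022FlipGraphs, §2 (symmetry group)] -/
theorem InSymmetryGroup.pow {φ : Symmetry (matMulTensor K n n n)} (hφ : InSymmetryGroup φ) (k : ℕ) :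
    InSymmetryGroup (φ.pow k) := by
  induction k with
  | zero => exact InSymmetryGroup.refl
  | succ k ih => exact ih.trans hφ

/-- Every element of the cyclic group generated by `φ ∈ G` lies in `G`.
[cite: KauersMoosbauer2022FlipGraphs, §2 (symmetry group)] -/
theorem InSymmetryGroup.cyclicRep {φ : Symmetry (matMulTensor K n n n)} (hφ : InSymmetryGroup φ)
    (m : ℕ) (g : Multiplicative (ZMod m)) : InSymmetryGroup (φ.cyclicRep m g) :=
  hφ.pow _

end MatMul

end FlipGraph

end Literature.Computability.AlgebraicComplexity
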